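import Summits.AtomisticToContinuum.Crystallization.Theorems.FrustratedLawDichotomyTextureCoarseSites
import Summits.AtomisticToContinuum.Crystallization.Theorems.FrustratedLawDichotomyHardCoreUpgrade

/-!
# FrustratedLawDichotomy · crux `AperiodicFrustratedLawGap` (stmt-AtomisticToContinuum-27623) — the COARSE-SITE local-excess door
# (decomp-a2c, prover hand 1, direct share, generation 6; twin of `FrustratedLawDichotomyPositiveExcessDoor` at the coarse sites)

`aperiodicFrustratedLawGap_of_positiveCoarseExcess` (+ the `PeriodicChargeSplit` copy): a measurable LOCAL EXCESS DENSITY `loc ≥ 0` on rooted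
configurations which is POSITIVE whenever the ROOT is NOT ROBUSTLY `1/8`-GOOD (fcc nor hcp) — i.e. at the coarse / icosahedral / TCP sites of the
texture — and satisfies the Theil-type law bound `E_P[loc] ≤ E_P[rootEnergy] − e⋆` for every point-stationary `7/10`-hard-core probability law,
implies the crux BY NAME: `E_P[loc] = 0` forces `loc = 0` a.s., but `{loc > 0}` is a measurable hull of the coarse roots, which have Palm
probability `≥ 1/C(7/10, R₉) > 0` by `inv_le_prob_coarseRoot` (texture transfer IV).  No slack `ε` and no uniform price appear.  Together with the
fine-site door this says: a PRICE at EITHER kind of frustrated site closes `AperiodicFrustratedLawGap`.  All `[folklore]`.  No definitions, no `sorry`.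
-/

noncomputable section

namespace Summit.AtomisticToContinuum.Crystallization.Theorems.FrustratedLawDichotomyCoarseExcessDoor

open MeasureTheory Metric Set Filter ProbabilityTheory
open scoped ENNReal
open Literature.Probability.Process
open Summit.AtomisticToContinuum.Crystallization.Theorems.FrustratedLawDichotomyTextureCoarseSites (inv_le_prob_coarseRoot)
open Summit.AtomisticToContinuum.Crystallization.Theorems.FrustratedLawDichotomyHardCoreUpgrade (aperiodicFrustratedLawGap_iff_sep07)

/-- **DOOR — `AperiodicFrustratedLawGap` from a local excess density that is POSITIVE AT COARSE ROOTS.**  See the module docstring. [folklore] -/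
theorem aperiodicFrustratedLawGap_of_positiveCoarseExcess
    (hloc : (∃ loc : MeasureTheory.Measure (EuclideanSpace ℝ (Fin 3)) → ℝ≥0∞, Measurable loc ∧
      (∀ ν : MeasureTheory.Measure (EuclideanSpace ℝ (Fin 3)),
          (∀ (d η γ : ℝ) (A : EuclideanSpace ℝ (Fin 3) →ₗᵢ[ℝ] EuclideanSpace ℝ (Fin 3)),
      (∀ t : ↥Literature.Geometry.DiscreteGeometry.fccKissingPattern → EuclideanSpace ℝ (Fin 3),
        ¬ (0 < d ∧ 0 < γ ∧ η < 1 / 8 ∧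
          (∀ u : ↥Literature.Geometry.DiscreteGeometry.fccKissingPattern, ν {t u} ≠ 0 ∧ ‖(t u - 0) - d • A (u : EuclideanSpace ℝ (Fin 3))‖ ≤ η * d) ∧
          (∀ s : EuclideanSpace ℝ (Fin 3), ν {s} ≠ 0 → s ≠ 0 → d ≤ dist s 0) ∧
          (∃ s : EuclideanSpace ℝ (Fin 3), ν {s} ≠ 0 ∧ s ≠ 0 ∧ dist s 0 ≤ d) ∧
          (∀ s : EuclideanSpace ℝ (Fin 3), ν {s} ≠ 0 → s ≠ 0 → dist s 0 < 13 / 10 * d + γ → dist s 0 ≤ 13 / 10 * d - γ ∧ s ∈ Set.range t))) ∧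
      (∀ t : ↥Literature.Geometry.DiscreteGeometry.hcpKissingPattern → EuclideanSpace ℝ (Fin 3),
        ¬ (0 < d ∧ 0 < γ ∧ η < 1 / 8 ∧
          (∀ u : ↥Literature.Geometry.DiscreteGeometry.hcpKissingPattern, ν {t u} ≠ 0 ∧ ‖(t u - 0) - d • A (u : EuclideanSpace ℝ (Fin 3))‖ ≤ η * d) ∧
          (∀ s : EuclideanSpace ℝ (Fin 3), ν {s} ≠ 0 → s ≠ 0 → d ≤ dist s 0) ∧
          (∃ s : EuclideanSpace ℝ (Fin 3), ν {s} ≠ 0 ∧ s ≠ 0 ∧ dist s 0 ≤ d) ∧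
          (∀ s : EuclideanSpace ℝ (Fin 3), ν {s} ≠ 0 → s ≠ 0 → dist s 0 < 13 / 10 * d + γ → dist s 0 ≤ 13 / 10 * d - γ ∧ s ∈ Set.range t)))) → 0 < loc ν) ∧
      (∀ P : MeasureTheory.Measure (MeasureTheory.Measure (EuclideanSpace ℝ (Fin 3))), MeasureTheory.IsProbabilityMeasure P →
        (∀ᵐ μ ∂P, Literature.Probability.Process.IsRootedHardCore (7 / 10) μ) → Literature.Probability.Process.IsPointStationaryLaw P →
        ∫⁻ μ, loc μ ∂P ≤ ENNReal.ofReal ((∫ μ, Literature.MathematicalPhysics.StatisticalMechanics.rootEnergy Literature.MathematicalPhysics.StatisticalMechanics.lennardJones μ ∂P) -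
          ⨅ Q : Literature.MathematicalPhysics.StatisticalMechanics.PeriodicConfiguration 3, Q.energyPerParticle Literature.MathematicalPhysics.StatisticalMechanics.lennardJones)))) :
    Summit.AtomisticToContinuum.Crystallization.Theses.FrustratedLawDichotomy.AperiodicFrustratedLawGap := by
  obtain ⟨loc, hlocm, hpos, hmean⟩ := hloc
  rw [aperiodicFrustratedLawGap_iff_sep07]
  intro P
  dsimp only
  intro hP ha hb hd he h0
  obtain ⟨R₇, R₈, R₉, hd'⟩ := hd
  obtain ⟨C, hC⟩ := inv_le_prob_coarseRoot (7 / 10) (by norm_num) R₉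
  have hCP := hC P
  dsimp only at hCP
  by_contra hlt
  rw [not_lt] at hlt
  have hzero : ∫⁻ μ, loc μ ∂P = 0 := by
    have h := hmean P hP ha hb
    rw [ENNReal.ofReal_eq_zero.2 (sub_nonpos.2 hlt)] at h
    exact le_zero_iff.1 h
  have hae : loc =ᵐ[P] 0 := (lintegral_eq_zero_iff hlocm).1 hzero
  have hnull : P {ν : MeasureTheory.Measure (EuclideanSpace ℝ (Fin 3)) | 0 < loc ν} = 0 := by
    refine measure_mono_null (fun ν hν => ?_) (ae_iff.1 hae)
    simp only [Set.mem_setOf_eq, Pi.zero_apply] at hν ⊢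
    exact ne_of_gt hν
  have hA : MeasurableSet {ν : MeasureTheory.Measure (EuclideanSpace ℝ (Fin 3)) | 0 < loc ν} := measurableSet_lt measurable_const hlocm
  have hfreq : (C : ℝ≥0∞)⁻¹ ≤ P {ν : MeasureTheory.Measure (EuclideanSpace ℝ (Fin 3)) | 0 < loc ν} :=
    hCP hP ha hb R₇ R₈ hd' _ hA (fun ν hN => hpos ν hN)
  rw [hnull, nonpos_iff_eq_zero, ENNReal.inv_eq_zero] at hfreq
  exact ENNReal.natCast_ne_top C hfreq

/-- The same door for the `PeriodicChargeSplit` copy of the shared crux decl. [folklore] -/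
theorem periodicChargeSplit_aperiodicFrustratedLawGap_of_positiveCoarseExcess
    (hloc : (∃ loc : MeasureTheory.Measure (EuclideanSpace ℝ (Fin 3)) → ℝ≥0∞, Measurable loc ∧
      (∀ ν : MeasureTheory.Measure (EuclideanSpace ℝ (Fin 3)),
          (∀ (d η γ : ℝ) (A : EuclideanSpace ℝ (Fin 3) →ₗᵢ[ℝ] EuclideanSpace ℝ (Fin 3)),
      (∀ t : ↥Literature.Geometry.DiscreteGeometry.fccKissingPattern → EuclideanSpace ℝ (Fin 3),
        ¬ (0 < d ∧ 0 < γ ∧ η < 1 / 8 ∧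
          (∀ u : ↥Literature.Geometry.DiscreteGeometry.fccKissingPattern, ν {t u} ≠ 0 ∧ ‖(t u - 0) - d • A (u : EuclideanSpace ℝ (Fin 3))‖ ≤ η * d) ∧
          (∀ s : EuclideanSpace ℝ (Fin 3), ν {s} ≠ 0 → s ≠ 0 → d ≤ dist s 0) ∧
          (∃ s : EuclideanSpace ℝ (Fin 3), ν {s} ≠ 0 ∧ s ≠ 0 ∧ dist s 0 ≤ d) ∧
          (∀ s : EuclideanSpace ℝ (Fin 3), ν {s} ≠ 0 → s ≠ 0 → dist s 0 < 13 / 10 * d + γ → dist s 0 ≤ 13 / 10 * d - γ ∧ s ∈ Set.range t))) ∧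
      (∀ t : ↥Literature.Geometry.DiscreteGeometry.hcpKissingPattern → EuclideanSpace ℝ (Fin 3),
        ¬ (0 < d ∧ 0 < γ ∧ η < 1 / 8 ∧
          (∀ u : ↥Literature.Geometry.DiscreteGeometry.hcpKissingPattern, ν {t u} ≠ 0 ∧ ‖(t u - 0) - d • A (u : EuclideanSpace ℝ (Fin 3))‖ ≤ η * d) ∧
          (∀ s : EuclideanSpace ℝ (Fin 3), ν {s} ≠ 0 → s ≠ 0 → d ≤ dist s 0) ∧
          (∃ s : EuclideanSpace ℝ (Fin 3), ν {s} ≠ 0 ∧ s ≠ 0 ∧ dist s 0 ≤ d) ∧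
          (∀ s : EuclideanSpace ℝ (Fin 3), ν {s} ≠ 0 → s ≠ 0 → dist s 0 < 13 / 10 * d + γ → dist s 0 ≤ 13 / 10 * d - γ ∧ s ∈ Set.range t)))) → 0 < loc ν) ∧
      (∀ P : MeasureTheory.Measure (MeasureTheory.Measure (EuclideanSpace ℝ (Fin 3))), MeasureTheory.IsProbabilityMeasure P →
        (∀ᵐ μ ∂P, Literature.Probability.Process.IsRootedHardCore (7 / 10) μ) → Literature.Probability.Process.IsPointStationaryLaw P →
        ∫⁻ μ, loc μ ∂P ≤ ENNReal.ofReal ((∫ μ, Literature.MathematicalPhysics.StatisticalMechanics.rootEnergy Literature.MathematicalPhysics.StatisticalMechanics.lennardJones μ ∂P) -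
          ⨅ Q : Literature.MathematicalPhysics.StatisticalMechanics.PeriodicConfiguration 3, Q.energyPerParticle Literature.MathematicalPhysics.StatisticalMechanics.lennardJones)))) :
    Summit.AtomisticToContinuum.Crystallization.Theses.PeriodicChargeSplit.AperiodicFrustratedLawGap :=
  aperiodicFrustratedLawGap_of_positiveCoarseExcess hloc

end Summit.AtomisticToContinuum.Crystallization.Theorems.FrustratedLawDichotomyCoarseExcessDoor

end
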